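import Literature.MathematicalPhysics.QuantumFieldTheory.Balaban1983to89.Node00.BackgroundActionT
import Literature.MathematicalPhysics.QuantumFieldTheory.Balaban1983to89.Node00.SmallFieldChiFixedOfRecord
import Literature.MathematicalPhysics.QuantumFieldTheory.Balaban1983to89.Node00.Record9

/-!
# NODE 00 (YM-PLAN Track A) — THE CONTINUOUS-VERSION TRANSPORT OF RECORD `TcOfRecord` and the β OF RECORD READ THROUGH IT
# ([Balaban1987RG1] (0.13) p. 254 «(Tρ)(V) = ∫ dU δ(Ū(U)V⁻¹) χ … ρ(U)», (0.19) p. 255, (1.20)–(1.22) p. 264; [Balaban1988Convergent] (3.1) p. 264)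

NODE 00 DEFINITION-LANE MODULE (seat pub-ymgap-node00-def-T, DEFINER (T-side); director LINE №44 = RIDER OF RECORD №6 «β-VERSION» (b) and LINE №45 (2);
dag-ref-D g8 READ OF RECORD l.10880 criterion «β must read a POINTWISE-DETERMINED density: the explicit fibre integral (0.13), or a continuous-density
transport, or the term tower»).  THIS FILE TYPES THE «CONTINUOUS-DENSITY TRANSPORT» BRANCH.  Count-neutral; nothing of Bałaban's asserted.

THE TYPING FACT REPAIRED.  Every renormalisation transform in the tree so far is a CHOSEN VERSION of an a.e.-defined object: Stage 5's
`TrhoOfRecord = rnTransport …` (a Radon–Nikodym derivative of the push-forward), and FILE 1's kernel transport `transportOfRecord = transportK …`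
(`kernelTransport`: `(Tρ)(V') = margDensity(V') · ∫ ρ dcondLaw(V')` with `margDensity = rnNN … = (rnDeriv …).toNNReal` and `condLaw = condKernel` —
Mathlib's chosen versions; ERRATUM [NODE00-DEF-T-G2-ERRATUM-VERSION] 2026-08-26 to `Record9`'s docstring sentence «no `rnDeriv` in any object of record»,
which is too strong: TRUE is «no Stage-5 `rnTransport`; kernel FORM»).  A β defined as a pointwise second derivative of the logarithm of such a
version (`betaOfRecord₈ ∕ ₈χ ∕ ₉`) has point values no theorem pins (A2 junk-value class; dag-n26-a, ref-D).  In print the transform (0.13) is an explicit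
fibre integral, a regular function of `V` for the densities of the procedure.

THE MOVE (version-independence by continuity).  On a measure charging every non-empty open set, two CONTINUOUS functions that agree a.e. agree
EVERYWHERE (Mathlib `Continuous.ae_eq_iff_eq`).  Hence «the continuous version of `f`, if `f` has one» is a POINTWISE-DETERMINED function of the
a.e.-CLASS of `f`: it does not depend on the representative one starts from (`contVersion_congr_ae`), and it equals any continuous representative
one can exhibit (`contVersion_eq_of_continuous`) — in particular print's (0.13) fibre integral wherever that is continuous.  Product Haar measure on
`SU(N)`-valued lattice gauge fields charges open sets (`isOpenPosMeasure_piHaar_SUN`).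

CONTENT.
* §1 generic: `HasContVersion μ f`, `contVersion μ f` (junk `0` when no continuous version exists — chosen so that version-independence is
  UNCONDITIONAL), `continuous_contVersion` (unconditional), `contVersion_ae_eq`, `hasContVersion_congr_ae`, `contVersion_eq_of_continuous`,
  `contVersion_congr_ae`, `contVersion_of_continuous`.
* §2 gauge fields (the Pi topology on `PBond P (j+1) → G`; NO instance is declared on `GaugeField`): `piHaar P j G` (= `fieldMeasure`, `rfl`),
  `transportC avg ρ := contVersion (piHaar …) (transportK avg ρ)` — THE CONTINUOUS-VERSION TRANSPORT; `continuous_transportC`; `transportC_ae_eq`;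
  `transportC_eq_of_continuous` (DETERMINACY); `transportC_eq_contVersion_of_ae_eq` (VERSION-INDEPENDENCE: starting from ANY a.e.-representative of
  the kernel transport gives the same function); `isRT_transportC` (it IS a renormalisation transformation of `ρ`, from `isRT_kernelTransport` by
  `integral_congr_ae`, under the displayed existence hypothesis).
* §3 at the record (`G = SU(N)`, averaging `avOfRecord`): `isOpenPosMeasure_piHaar_SUN`; `TcOfRecord F N : Transport F N` (def-B's transport-family
  type of `Node00/BackgroundActionT`); `HasContTransportAt` (the located existence hypothesis, DISPLAYED, never asserted); `TcOfRecord_eq_of_continuous`,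
  `TcOfRecord_eq_of_ae_eq_transportOfRecord`, `continuous_TcOfRecord`, `isRT_TcOfRecord`; the β OF RECORD OVER A TRANSPORT FAMILY with def-χ's
  fixed-threshold χ (R1): `betaOfRecord₈T T θ` (₈'s formula with `mergedTermFamilyMatT … T (chiFixed7 θ.ν)`), `betaOfRecord₈T_TOfRecord :
  betaOfRecord₈T (TOfRecord) θ = betaOfRecord₈χ θ` (`rfl` — def-χ's β IS the `T := TOfRecord` instance), **`betaOfRecord₈c θ := betaOfRecord₈T (TcOfRecord) θ`**
  and **`betaOfRecord₉c θ := betaOfRecord₈c θ.toStage8Params`** — the β whose inputs `A_{k+1} = log(𝐍⁻¹ · (T_k …))` read the CONTINUOUS-VERSION transport: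
  every point value DETERMINED by the a.e.-class of the transform, flow-blind in χ.
NOT HERE (said, not done): the successor RECORD carrying `βfun := betaOfRecord₉c` (`Record10` ∕ `Record9Beta`, after ref-D reads this file); the
EXISTENCE of continuous versions along the record (print: regularity of (0.13)'s fibre integrals — [Balaban1985Averaging] §1, [Balaban1987RG1] p. 254 —
displayed as `HasContTransportAt`, a later theorem or a residual, never asserted here; where it fails `TcOfRecord` returns the junk `0` and β reads
DETERMINED junk); def-B's print-faithful β off the term tower ([I] (2.9), hand (iii)) — the other branch of ref-D's criterion; agreement of the two
where both exist is a theorem for later, not asserted.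

HONEST FRAMING: definitions of record + kernel-checked bookkeeping (`rfl` ∕ Mathlib's uniqueness of continuous versions); nothing of Bałaban's
asserted; no estimate; counts unmoved (5∕27 R444; 5∕28 of record); one finite T⁴ at fixed ε — NOT continuum ∕ OS ∕ mass gap ∕ Clay.
-/

noncomputable section

open MeasureTheory

namespace Literature.MathematicalPhysics.QuantumFieldTheory.Balaban1983to89.Node00

open T4Continuum (T4Family)
open FlowStep (HBeta)
open scoped Matrix.Norms.L2Operator
open T4AveragingDisintegration (transportK kernelTransport isRT_kernelTransport)
open T4FiniteEpsInhabited (HaarAC)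
open B12Eq019ActionBody (integrand)

/-! ## §1. The continuous version of an a.e.-defined real function -/

section Generic

variable {α : Type*} [TopologicalSpace α] [MeasurableSpace α]

/-- `f` admits a continuous version w.r.t. `μ`. [cite: Balaban1987RG1, (0.13) p.254 (bookkeeping: the regularity reading of the transform)] -/
def HasContVersion (μ : Measure α) (f : α → ℝ) : Prop :=
  ∃ g : α → ℝ, Continuous g ∧ g =ᵐ[μ] f

/-- THE CONTINUOUS VERSION of `f` w.r.t. `μ` (junk `0` if there is none). [folklore] -/
def contVersion (μ : Measure α) (f : α → ℝ) : α → ℝ :=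
  open Classical in if h : HasContVersion μ f then h.choose else 0

/-- The defining property of the continuous version, when one exists. [cite: Balaban1987RG1, (0.13) p.254 (bookkeeping)] -/
theorem contVersion_spec {μ : Measure α} {f : α → ℝ} (h : HasContVersion μ f) :
    Continuous (contVersion μ f) ∧ contVersion μ f =ᵐ[μ] f := by
  unfold contVersion; rw [dif_pos h]; exact h.choose_spec

/-- The continuous version is continuous — unconditionally (the junk branch is the constant `0`). [cite: Balaban1987RG1, (0.13) p.254 (bookkeeping)] -/
theorem continuous_contVersion (μ : Measure α) (f : α → ℝ) : Continuous (contVersion μ f) := by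
  by_cases h : HasContVersion μ f
  · exact (contVersion_spec h).1
  · unfold contVersion; rw [dif_neg h]; exact continuous_const

/-- When a continuous version exists, `contVersion μ f` is a version of `f`. [cite: Balaban1987RG1, (0.13) p.254 (bookkeeping)] -/
theorem contVersion_ae_eq {μ : Measure α} {f : α → ℝ} (h : HasContVersion μ f) : contVersion μ f =ᵐ[μ] f :=
  (contVersion_spec h).2

/-- Existence of a continuous version depends only on the a.e.-class. [cite: Balaban1987RG1, (0.13) p.254 (bookkeeping)] -/
theorem hasContVersion_congr_ae {μ : Measure α} {f₁ f₂ : α → ℝ} (h : f₁ =ᵐ[μ] f₂) :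
    HasContVersion μ f₁ ↔ HasContVersion μ f₂ :=
  ⟨fun ⟨g, hg, hgf⟩ => ⟨g, hg, hgf.trans h⟩, fun ⟨g, hg, hgf⟩ => ⟨g, hg, hgf.trans h.symm⟩⟩

/-- **POINTWISE DETERMINACY.** On a measure positive on non-empty open sets, ANY continuous representative of `f` IS `contVersion μ f` —
everywhere, not just a.e. (Mathlib `Continuous.ae_eq_iff_eq`). [cite: Balaban1987RG1, (0.13) p.254 (bookkeeping)] -/
theorem contVersion_eq_of_continuous {μ : Measure α} [μ.IsOpenPosMeasure] {f g : α → ℝ} (hg : Continuous g) (hgf : g =ᵐ[μ] f) :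
    contVersion μ f = g := by
  have h : HasContVersion μ f := ⟨g, hg, hgf⟩
  exact (Continuous.ae_eq_iff_eq μ (contVersion_spec h).1 hg).1 ((contVersion_spec h).2.trans hgf.symm)

/-- **VERSION-INDEPENDENCE.** On a measure positive on non-empty open sets, a.e.-equal functions have THE SAME continuous version (as functions,
everywhere) — unconditionally (both junk when neither has one). [cite: Balaban1987RG1, (0.13) p.254 (bookkeeping)] -/
theorem contVersion_congr_ae {μ : Measure α} [μ.IsOpenPosMeasure] {f₁ f₂ : α → ℝ} (h : f₁ =ᵐ[μ] f₂) :
    contVersion μ f₁ = contVersion μ f₂ := by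
  by_cases h₁ : HasContVersion μ f₁
  · exact (contVersion_eq_of_continuous (contVersion_spec h₁).1 ((contVersion_spec h₁).2.trans h)).symm
  · have h₂ : ¬ HasContVersion μ f₂ := fun h₂ => h₁ ((hasContVersion_congr_ae h).2 h₂)
    unfold contVersion; rw [dif_neg h₁, dif_neg h₂]

/-- A continuous function is its own continuous version. [cite: Balaban1987RG1, (0.13) p.254 (bookkeeping)] -/
theorem contVersion_of_continuous {μ : Measure α} [μ.IsOpenPosMeasure] {f : α → ℝ} (hf : Continuous f) : contVersion μ f = f :=
  contVersion_eq_of_continuous hf (ae_eq_refl f)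

/-- The junk branch: no continuous version ⇒ `contVersion μ f = 0`. [cite: Balaban1987RG1, (0.13) p.254 (bookkeeping)] -/
theorem contVersion_of_not {μ : Measure α} {f : α → ℝ} (h : ¬ HasContVersion μ f) : contVersion μ f = 0 := by
  unfold contVersion; rw [dif_neg h]

end Generic

/-! ## §2. The continuous-version transport on lattice gauge fields -/

section Gauge

variable (P : Params) (j : ℕ) (G : Type*) [GaugeGroup G] [MeasurableSpace G] [HaarData G]

/-- Product Haar measure on the RAW configuration type `PBond P j → G` (which carries the Pi topology; NO instance is declared on `GaugeField`); it IS
`fieldMeasure P j G` (`piHaar_eq_fieldMeasure`, `rfl`). [cite: Balaban1985Averaging, (10) p.19 (bookkeeping)] -/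
def piHaar : Measure (PBond P j → G) := Measure.pi (fun _ : PBond P j => (HaarData.haar : Measure G))

/-- `piHaar` is the field measure of the tree (definitional). [cite: Balaban1985Averaging, (10) p.19 (bookkeeping)] -/
theorem piHaar_eq_fieldMeasure : piHaar P j G = fieldMeasure P j G := rfl

variable {P j G}
variable [TopologicalSpace G] [StandardBorelSpace G]

/-- **THE CONTINUOUS-VERSION TRANSPORT** of a density along an averaging map: the continuous version (w.r.t. product Haar measure of the coarse
lattice, Pi topology) of the kernel transport `transportK avg ρ` — print's `(Tρ)(V) = ∫ dU δ(Ū(U)V⁻¹) ρ(U)` read as THE continuous function in its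
a.e.-class (junk `0` if there is none). [cite: Balaban1987RG1, (0.13) p.254; Balaban1988Convergent, (3.1) p.264] -/
def transportC (avg : GaugeField P j G → GaugeField P (j+1) G) (ρ : Density P j G) : Density P (j+1) G :=
  contVersion (α := PBond P (j+1) → G) (piHaar P (j+1) G) (fun V => transportK avg ρ V)

/-- Unfolding (`rfl`). [cite: Balaban1987RG1, (0.13) p.254 (bookkeeping)] -/
theorem transportC_def (avg : GaugeField P j G → GaugeField P (j+1) G) (ρ : Density P j G) :
    transportC avg ρ = contVersion (α := PBond P (j+1) → G) (piHaar P (j+1) G) (fun V => transportK avg ρ V) := rfl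

/-- The continuous-version transport is continuous (Pi topology), unconditionally. [cite: Balaban1987RG1, (0.13) p.254 (bookkeeping)] -/
theorem continuous_transportC (avg : GaugeField P j G → GaugeField P (j+1) G) (ρ : Density P j G) :
    Continuous (fun V : PBond P (j+1) → G => transportC avg ρ V) :=
  continuous_contVersion (α := PBond P (j+1) → G) (piHaar P (j+1) G) (fun V => transportK avg ρ V)

/-- Under the existence hypothesis it is a version of the kernel transport. [cite: Balaban1987RG1, (0.13) p.254 (bookkeeping)] -/
theorem transportC_ae_eq {avg : GaugeField P j G → GaugeField P (j+1) G} {ρ : Density P j G}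
    (hex : HasContVersion (piHaar P (j+1) G) (fun V => transportK avg ρ V)) :
    (fun V : PBond P (j+1) → G => transportC avg ρ V) =ᵐ[piHaar P (j+1) G] (fun V => transportK avg ρ V) :=
  contVersion_ae_eq hex

/-- **DETERMINACY at the gauge-field level**: any continuous a.e.-representative of the kernel transport IS `transportC avg ρ` — at every coarse field.
[cite: Balaban1987RG1, (0.13) p.254 (bookkeeping)] -/
theorem transportC_eq_of_continuous [(piHaar P (j+1) G).IsOpenPosMeasure] {avg : GaugeField P j G → GaugeField P (j+1) G} {ρ : Density P j G}
    {g : (PBond P (j+1) → G) → ℝ} (hg : Continuous g) (hae : g =ᵐ[piHaar P (j+1) G] (fun V => transportK avg ρ V)) :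
    transportC avg ρ = g :=
  contVersion_eq_of_continuous hg hae

/-- **VERSION-INDEPENDENCE at the gauge-field level**: the continuous version of ANY a.e.-representative `ρ'` of the kernel transport (an RN
transport, an explicit fibre integral, …) is `transportC avg ρ`. [cite: Balaban1987RG1, (0.13) p.254 (bookkeeping)] -/
theorem transportC_eq_contVersion_of_ae_eq [(piHaar P (j+1) G).IsOpenPosMeasure] {avg : GaugeField P j G → GaugeField P (j+1) G}
    {ρ : Density P j G} {ρ' : (PBond P (j+1) → G) → ℝ} (hae : ρ' =ᵐ[piHaar P (j+1) G] (fun V => transportK avg ρ V)) :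
    contVersion (piHaar P (j+1) G) ρ' = transportC avg ρ :=
  contVersion_congr_ae hae

/-- The continuous-version transport IS a renormalisation transformation of every integrable `ρ` whose kernel transport has a continuous version
(the push-forward identity transferred along the a.e.-equality). [cite: Balaban1985Averaging, (10) p.19; Balaban1987RG1, (0.13) p.254] -/
theorem isRT_transportC {avg : GaugeField P j G → GaugeField P (j+1) G} (havg : Measurable avg) (hac : HaarAC avg) {ρ : Density P j G}
    (hρ : Integrable ρ (fieldMeasure P j G)) (hex : HasContVersion (piHaar P (j+1) G) (fun V => transportK avg ρ V)) :
    IsRT avg ρ (transportC avg ρ) := by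
  intro f hf hfC
  rw [← isRT_kernelTransport havg hac ρ hρ f hf hfC]
  refine integral_congr_ae ?_
  exact (transportC_ae_eq hex).mono fun V hV => congrArg (· * f V) hV

end Gauge

/-! ## §3. At the record: `G = SU(N)`, the block averaging of record, def-B's transport-family layer, def-χ's fixed-threshold χ -/

variable (F : T4Family) (N : ℕ) [NeZero N]

/-- Product Haar measure on `SU(N)`-valued lattice gauge fields charges every non-empty open set (normalised Haar on the compact group `SU(N)` does,
and finite products preserve it). [cite: BrockerTomDieck1985, I (5.12) (bookkeeping)] -/
theorem isOpenPosMeasure_piHaar_SUN (P : Params) (j : ℕ) : (piHaar P j (SU N)).IsOpenPosMeasure := by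
  haveI : (HaarData.haar : Measure (SU N)).IsOpenPosMeasure := by
    show (haarProbability (SU N)).IsOpenPosMeasure
    unfold haarProbability; infer_instance
  unfold piHaar; infer_instance

/-- **THE CONTINUOUS-VERSION TRANSPORT OF RECORD** as a transport family (def-B's `Transport F N`): per torus `K` and step `k`, the continuous version
of FILE 1's kernel transport along the block averaging of record `avOfRecord F N K k`. [cite: Balaban1987RG1, (0.13) p.254, (0.19) p.255] -/
def TcOfRecord : Transport F N := fun K k => transportC (avOfRecord F N K k).avg

/-- THE LOCATED EXISTENCE HYPOTHESIS at one density (displayed, never asserted): the transform of record of `ρ` at step `k` of the `K`-th torus admits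
a continuous version (print: the (0.13) fibre integrals of the procedure's densities are regular functions of `V`).
[cite: Balaban1987RG1, (0.13) p.254; Balaban1985Averaging, (10) p.19] -/
def HasContTransportAt (K k : ℕ) (ρ : Density (F.P K) k (SU N)) : Prop :=
  HasContVersion (piHaar (F.P K) (k + 1) (SU N)) (fun V => transportOfRecord F N K k ρ V)

variable {F N}

/-- `TcOfRecord` unfolds to the continuous version of FILE 1's `transportOfRecord` (`rfl`). [cite: Balaban1988Convergent, (3.1) p.264 (bookkeeping)] -/
theorem TcOfRecord_apply (K k : ℕ) (ρ : Density (F.P K) k (SU N)) :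
    TcOfRecord F N K k ρ = contVersion (piHaar (F.P K) (k + 1) (SU N)) (fun V => transportOfRecord F N K k ρ V) := rfl

/-- `TcOfRecord F N K k ρ` is continuous in the coarse field, unconditionally. [cite: Balaban1987RG1, (0.13) p.254 (bookkeeping)] -/
theorem continuous_TcOfRecord (K k : ℕ) (ρ : Density (F.P K) k (SU N)) :
    Continuous (fun V : PBond (F.P K) (k + 1) → SU N => TcOfRecord F N K k ρ V) :=
  continuous_transportC _ _

/-- **DETERMINACY AT THE RECORD (by name)**: a continuous a.e.-representative of the transform of record IS `TcOfRecord F N K k ρ`, at EVERY coarse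
field `V`. [cite: Balaban1987RG1, (0.13) p.254 (bookkeeping)] -/
theorem TcOfRecord_eq_of_continuous {K k : ℕ} {ρ : Density (F.P K) k (SU N)} {g : (PBond (F.P K) (k + 1) → SU N) → ℝ}
    (hg : Continuous g) (hae : g =ᵐ[piHaar (F.P K) (k + 1) (SU N)] (fun V => transportOfRecord F N K k ρ V)) :
    TcOfRecord F N K k ρ = g :=
  haveI := isOpenPosMeasure_piHaar_SUN N (F.P K) (k + 1)
  transportC_eq_of_continuous hg hae

/-- **VERSION-INDEPENDENCE AT THE RECORD (by name)**: the continuous version of ANY a.e.-representative of the transform of record is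
`TcOfRecord F N K k ρ`. [cite: Balaban1987RG1, (0.13) p.254 (bookkeeping)] -/
theorem TcOfRecord_eq_contVersion_of_ae_eq {K k : ℕ} {ρ : Density (F.P K) k (SU N)} {ρ' : (PBond (F.P K) (k + 1) → SU N) → ℝ}
    (hae : ρ' =ᵐ[piHaar (F.P K) (k + 1) (SU N)] (fun V => transportOfRecord F N K k ρ V)) :
    contVersion (piHaar (F.P K) (k + 1) (SU N)) ρ' = TcOfRecord F N K k ρ :=
  haveI := isOpenPosMeasure_piHaar_SUN N (F.P K) (k + 1)
  transportC_eq_contVersion_of_ae_eq hae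

/-- Under the existence hypothesis `TcOfRecord` is a version of the transform of record … [cite: Balaban1988Convergent, (3.1) p.264 (bookkeeping)] -/
theorem TcOfRecord_ae_eq {K k : ℕ} {ρ : Density (F.P K) k (SU N)} (hex : HasContTransportAt F N K k ρ) :
    (fun V : PBond (F.P K) (k + 1) → SU N => TcOfRecord F N K k ρ V) =ᵐ[piHaar (F.P K) (k + 1) (SU N)]
      (fun V => transportOfRecord F N K k ρ V) :=
  transportC_ae_eq hex

/-- … and a renormalisation transformation of every integrable `ρ`, at every step `k < K`.
[cite: Balaban1985Averaging, (10) p.19; Balaban1988Convergent, (3.1) p.264] -/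
theorem isRT_TcOfRecord {K k : ℕ} (hk : k < K) {ρ : Density (F.P K) k (SU N)} (hρ : Integrable ρ (fieldMeasure (F.P K) k (SU N)))
    (hex : HasContTransportAt F N K k ρ) : IsRT (avOfRecord F N K k).avg ρ (TcOfRecord F N K k ρ) :=
  isRT_transportC (avOfRecord_measurable F N K k) (avOfRecord_haarAC F N K k hk) hρ hex

variable (F N)

/-- **The β of record OVER A TRANSPORT FAMILY** with def-χ's fixed-threshold χ (R1): Stage 8's formula ([I] (1.20)–(1.22) on the merged term (1.6),
box convention) with `mergedTermFamilyMatT … T (chiFixed7 θ.ν)`. [cite: Balaban1987RG1, (1.20)–(1.22) p.264] -/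
def betaOfRecord₈T (T : Transport F N) (θ : Stage8Params F N) : HBeta :=
  letI := θ.instVβ₁; letI := θ.instVβ₂; letI := θ.instιβ
  betaOfMerged (betaMerged F (mergedTermFamilyMatT F N T (chiFixed7 F N θ.ν) θ.εbg) θ.ρ8 θ.bV)
    (beta0OfMerged (betaMerged F (mergedTermFamilyMatT F N T (chiFixed7 F N θ.ν) θ.εbg) θ.ρ8 θ.bV) θ.v₀) θ.γ

/-- def-χ's `betaOfRecord₈χ` IS the `T := TOfRecord` (Stage-5 RN transport) instance (`rfl` through `Node00/BackgroundActionT`'s bridge).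
[cite: Balaban1987RG1, (1.20)–(1.22) p.264 (bookkeeping)] -/
theorem betaOfRecord₈T_TOfRecord (θ : Stage8Params F N) : betaOfRecord₈T F N (TOfRecord F N) θ = betaOfRecord₈χ F N θ := rfl

/-- **THE β OF RECORD READ THROUGH THE CONTINUOUS-VERSION TRANSPORT** (Stage-8 parameters): every input `A_{k+1} = log(𝐍_k⁻¹ · (T_k …)(V))` now reads
`TcOfRecord`, whose point values are DETERMINED by the a.e.-class of the transform; χ fixed-threshold (flow-blind).
[cite: Balaban1987RG1, (1.20)–(1.22) p.264] -/
def betaOfRecord₈c (θ : Stage8Params F N) : HBeta := betaOfRecord₈T F N (TcOfRecord F N) θ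

/-- The same over Stage-9 parameters (the re-point a successor record `Record10 ∕ Record9Beta` would carry as `βfun`).
[cite: Balaban1987RG1, (1.20)–(1.22) p.264] -/
def betaOfRecord₉c (θ : Stage9Params F N) : HBeta := betaOfRecord₈c F N θ.toStage8Params

/-- Unfolding (`rfl`). [cite: Balaban1987RG1, (1.20)–(1.22) p.264 (bookkeeping)] -/
theorem betaOfRecord₉c_eq (θ : Stage9Params F N) : betaOfRecord₉c F N θ = betaOfRecord₈T F N (TcOfRecord F N) θ.toStage8Params := rfl

/-! ## §4. The located existence hypothesis ALONG THE β-LAYER (displayed, never asserted; a successor record certifies it inside its `Provisos`) -/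

/-- At transport family `T`, numerics `ν`, torus `K`, couplings `g` and step `k`: the density the β-layer transports at that step — (0.19)'s
`χ_k · exp[−GF/g_k² + A_k]` with `A_k` the effective action built with `T` itself and def-χ's fixed-threshold χ — has a transform of record admitting a
continuous version.  HONEST NOTE: with the SHARP indicator χ of record, continuity of the fibre integral at EVERY coarse field asks the boundary of the
small-field domain to be fibre-null at every `V`; print works on the analyticity domain of `A_{k+1}` ([Balaban1987RG1] p. 259–260), so a successor may
prefer an on-domain variant — this file displays the everywhere form. [cite: Balaban1987RG1, (0.19) p.255, p.259–260] -/
def HasContTransportAlongβ (T : Transport F N) (ν : Stage7Numerics) (K : ℕ) (g : ℕ → ℝ) (k : ℕ) : Prop :=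
  HasContTransportAt F N K k
    (integrand (chiFixed7 F N ν K g k) (gfOfRecord F N K k) (g k) (effActionHT F N T (chiFixed7 F N ν) K g k))

/-- THE θ-LEVEL PROVISO a successor record would certify (pub-ymgap plan g62 (c1)): along the continuous-version transport of record, at every torus,
coupling sequence and step `k < K`, the β-layer's transported density has a continuous transform. [cite: Balaban1987RG1, (0.13) p.254, (0.19) p.255] -/
def Stage8Params.HasContTransportAlong (θ : Stage8Params F N) : Prop :=
  ∀ (K : ℕ) (g : ℕ → ℝ) (k : ℕ), k < K → HasContTransportAlongβ F N (TcOfRecord F N) θ.ν K g k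

variable {F N} in
/-- Under the proviso, every input `(T_k(χ_k e^{−GF/g_k²+A_k}))` of `A_{k+1}` along the β-layer IS a version of FILE 1's kernel transform of that density
AND continuous — β reads genuine continuous fibre integrals. [cite: Balaban1987RG1, (0.19) p.255 (bookkeeping)] -/
theorem ae_eq_and_continuous_of_hasContTransportAlong {θ : Stage8Params F N} (h : θ.HasContTransportAlong) {K : ℕ} (g : ℕ → ℝ) {k : ℕ}
    (hk : k < K) :
    ((fun V : PBond (F.P K) (k + 1) → SU N => TcOfRecord F N K k (integrand (chiFixed7 F N θ.ν K g k) (gfOfRecord F N K k) (g k)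
        (effActionHT F N (TcOfRecord F N) (chiFixed7 F N θ.ν) K g k)) V) =ᵐ[piHaar (F.P K) (k + 1) (SU N)]
      (fun V => transportOfRecord F N K k (integrand (chiFixed7 F N θ.ν K g k) (gfOfRecord F N K k) (g k)
        (effActionHT F N (TcOfRecord F N) (chiFixed7 F N θ.ν) K g k)) V)) ∧
    Continuous (fun V : PBond (F.P K) (k + 1) → SU N => TcOfRecord F N K k (integrand (chiFixed7 F N θ.ν K g k) (gfOfRecord F N K k) (g k)
        (effActionHT F N (TcOfRecord F N) (chiFixed7 F N θ.ν) K g k)) V) :=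
  ⟨TcOfRecord_ae_eq (h K g k hk), continuous_TcOfRecord _ _ _⟩

end Literature.MathematicalPhysics.QuantumFieldTheory.Balaban1983to89.Node00

end
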